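/- EXTRA WIDTH seat `ym-line-cbag-p1-w4` (prover-ym-line-cbag-p1-w4-g13-0), LINE 7b `VolumeComparison` of route `GlueballBandRecursion`,
item ⟨stmt-QuantumFields-22957⟩ (`--supports`, helper; it closes nothing).  CORRECTED BINDER (width seat w2 g23, 2026-08-28T20:58Z): the lifting
identity holds only for periods `T ≥ 4` (time-wrapping sheets of `2a` plaquettes are closed, connected, kept and unliftable at `T = 2`), so the
consumable reductions are the ones HERE, with the hypothesis `LIFT` quantified over `4 ≤ T`; the twins in `…VolumeJetsOfLifting.lean`
(hypothesis over `1 < T`) remain true but have a hypothesis no lifting theorem will supply.  Def-free. -/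
import Summits.QuantumFields.YangMills.Theorems.GlueballBandRecursionVolumeJetsOfSupport

/-!
# Route `GlueballBandRecursion`, LINE 7b: the thermal free-energy jets from the lifting identity over periods `T ≥ 4`

Kept support sums `K_{b,T,k}(z) = Σ_{A ⊆ labels of b³×T : closed ∧ connected ∧ #A ≤ k} ψ(A)(z)` (written out), two-volume bound
`‖log Z(a'³×T)/a'³ − log Z(a³×T)/a³‖ ≤ 12T(‖z‖/(e r_ρ))^{4a−3}` whenever `K_{a',T,4(a−1)}/a'³ = K_{a,T,4(a−1)}/a³`
(`norm_tubeLogZ_div_sub_le_of_kept_eq`).  The LIFTING IDENTITY `LIFT`: that equality for all `4 ≤ a ≤ a'`, **`4 ≤ T`**, `‖z‖ ≤ r_ρ` (piece C3: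
closed connected supports with `≤ 4(a−1)` plaquettes are rooted at scale `a−1` in each spatial direction when ALL FOUR sides are `≥ 4` —
`SlabCount.exists_rooting_of_closed` — and lift between the boxes with equal `ψ`).  Here:

* §1 `norm_tubeRate_div_sub_le_of_lift` — `‖e_{a'}(z)/a'³ − e_a(z)/a³‖ ≤ 12(‖z‖/(e r_ρ))^{4a−3}` from the identity at every `T ≥ 4` (limit
  `T → ∞`, the LEAD's `tubeRate_spec`); `norm_volumeDiscrepancy_le_of_lift`: `‖volumeDiscrepancy ρ a a' t z‖ ≤ 24t(‖z‖/(e r_ρ))^{4a−3}`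
  (`t ≥ 4`); `norm_coldVolumeDiscrepancy_le_of_lift`: `‖coldVolumeDiscrepancy ρ a a' t z‖ ≤ 48t(‖z‖/(e r_ρ))^{4a−3}` (identity at `t`, `2t`).
* §2 **`thermalFreeEnergyVolumeJets_of_lift : LIFT → ThermalFreeEnergyVolumeJets`**, **`coldFreeEnergyVolumeJets_of_lift : LIFT →
  ColdFreeEnergyVolumeJets`** (exponent `4a − 3 ≥ 3a`; whole disc, explicit constants).

So LINE 7b's ∃-window rung hangs on `LIFT` (4 ≤ T) alone: `…VolumeComparisonOfJets` / `…ColdDefectComparisonOfJets` (LEAD) + the floor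
`traceExcessFloorAllSides_holds` (w5).

HONEST FRAMING.  Bookkeeping for the ∃-window strong-coupling RECORD rung; `LIFT` is a HYPOTHESIS here; nothing proves item 22957, the rung
`ColdDoublingRecursionStrongCoupling`, or the Yang–Mills mass gap / the summit `YangMills`.
-/

set_option autoImplicit false

noncomputable section

open MeasureTheory Finset Filter Topology Asymptotics
open Literature.Probability.LatticeModels
open Literature.MathematicalPhysics.QuantumFieldTheory
open Literature.MathematicalPhysics.QuantumFieldTheory.Balaban1983to89.Missing
open Summit.QuantumFields.YangMills.Theorems.GlueballBandRecursion.Support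

namespace Summit.QuantumFields.YangMills.Theorems.GlueballBandRecursion.Thermal

section TwoVolumes

variable {G : Type*} [Group G] [TopologicalSpace G] [IsTopologicalGroup G] [CompactSpace G] [MeasurableSpace G] [BorelSpace G]
  {N : ℕ} (ρ : G →* Matrix (Fin N) (Fin N) ℂ)
/-! ## §1 The tube rates and the volume discrepancies from the lifting identity over `T ≥ 4` -/

open scoped Classical in
/-- **Volume comparison of the tube-rate density, modulo lifting.**  If the kept sums at cutoff `4(a−1)` agree per site for every period
`T ≥ 4`, then `‖e_{a'}(z)/a'³ − e_a(z)/a³‖ ≤ 12·(‖z‖/(e r_ρ))^{4(a−1)+1}` (`e_b = tubeRate ρ b`: the limit `T → ∞` of §2 divided by `T`,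
through the LEAD's `tubeRate_spec`). -/
theorem norm_tubeRate_div_sub_le_of_lift (hρ : Continuous ρ) {a a' : ℕ} (ha : 1 < a) (haa' : a ≤ a') {z : ℂ}
    (hz : ‖z‖ ≤ strongCouplingRadius ρ)
    (hlift : ∀ T : ℕ, 4 ≤ T →
      (∑ A ∈ (Finset.univ : Finset (BoxLabel (![a', a', a', T] : Fin 4 → ℕ))).powerset with
            ((∀ p ∈ A, ∀ e ∈ p.bonds, ∃ q ∈ A, q ≠ p ∧ e ∈ q.bonds) ∧
              IsRConnected (boxSystem (G := G) ρ (![a', a', a', T] : Fin 4 → ℕ)).Adj A ∧ A.card ≤ 4 * (a - 1)),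
          ∑ 𝒞 ∈ (rconnSubsets (boxSystem (G := G) ρ (![a', a', a', T] : Fin 4 → ℕ)).Adj A).powerset with 𝒞.biUnion id = A,
            truncatedWeight (GeomInc (boxSystem (G := G) ρ (![a', a', a', T] : Fin 4 → ℕ)).Adj)
              (connActivity (boxSystem (G := G) ρ (![a', a', a', T] : Fin 4 → ℕ)).Adj (zdHaar 4 G)
                ((boxSystem (G := G) ρ (![a', a', a', T] : Fin 4 → ℕ)).weight z)) 𝒞) / ((a' : ℂ) ^ 3) =
      (∑ A ∈ (Finset.univ : Finset (BoxLabel (![a, a, a, T] : Fin 4 → ℕ))).powerset with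
            ((∀ p ∈ A, ∀ e ∈ p.bonds, ∃ q ∈ A, q ≠ p ∧ e ∈ q.bonds) ∧
              IsRConnected (boxSystem (G := G) ρ (![a, a, a, T] : Fin 4 → ℕ)).Adj A ∧ A.card ≤ 4 * (a - 1)),
          ∑ 𝒞 ∈ (rconnSubsets (boxSystem (G := G) ρ (![a, a, a, T] : Fin 4 → ℕ)).Adj A).powerset with 𝒞.biUnion id = A,
            truncatedWeight (GeomInc (boxSystem (G := G) ρ (![a, a, a, T] : Fin 4 → ℕ)).Adj)
              (connActivity (boxSystem (G := G) ρ (![a, a, a, T] : Fin 4 → ℕ)).Adj (zdHaar 4 G)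
                ((boxSystem (G := G) ρ (![a, a, a, T] : Fin 4 → ℕ)).weight z)) 𝒞) / ((a : ℂ) ^ 3)) :
    ‖tubeRate ρ a' z / ((a' : ℂ) ^ 3) - tubeRate ρ a z / ((a : ℂ) ^ 3)‖ ≤
      12 * (‖z‖ / (Real.exp 1 * strongCouplingRadius ρ)) ^ (4 * (a - 1) + 1) := by
  have ha' : 1 < a' := lt_of_lt_of_le ha haa'
  set q : ℝ := (‖z‖ / (Real.exp 1 * strongCouplingRadius ρ)) ^ (4 * (a - 1) + 1) with hq
  have hta := (tubeRate_spec ρ hρ (a := a) (by omega) hz).1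
  have hta' := (tubeRate_spec ρ hρ (a := a') (by omega) hz).1
  have hlim : Tendsto (fun k : ℕ => ‖tubeLogZ ρ a' (k + 1) z / ((k + 1 : ℕ) : ℂ) / ((a' : ℂ) ^ 3) -
      tubeLogZ ρ a (k + 1) z / ((k + 1 : ℕ) : ℂ) / ((a : ℂ) ^ 3)‖) atTop
      (𝓝 ‖tubeRate ρ a' z / ((a' : ℂ) ^ 3) - tubeRate ρ a z / ((a : ℂ) ^ 3)‖) :=
    ((hta'.div_const _).sub (hta.div_const _)).norm
  refine le_of_tendsto hlim (Filter.eventually_atTop.2 ⟨3, fun k hk => ?_⟩)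
  have hT4 : 4 ≤ k + 1 := by omega
  have hT : 1 < k + 1 := by omega
  have hk0 : (0 : ℝ) < ((k + 1 : ℕ) : ℝ) := by positivity
  have hk0' : ((k + 1 : ℕ) : ℂ) ≠ 0 := by exact_mod_cast (show k + 1 ≠ 0 by omega)
  have h := norm_tubeLogZ_div_sub_le_of_kept_eq ρ hρ ha haa' hT hz (hlift (k + 1) hT4)
  have heq : tubeLogZ ρ a' (k + 1) z / ((k + 1 : ℕ) : ℂ) / ((a' : ℂ) ^ 3) -
      tubeLogZ ρ a (k + 1) z / ((k + 1 : ℕ) : ℂ) / ((a : ℂ) ^ 3) =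
      (tubeLogZ ρ a' (k + 1) z / ((a' : ℂ) ^ 3) - tubeLogZ ρ a (k + 1) z / ((a : ℂ) ^ 3)) / ((k + 1 : ℕ) : ℂ) := by
    field_simp
  rw [heq, norm_div, Complex.norm_natCast, div_le_iff₀ hk0]
  calc ‖tubeLogZ ρ a' (k + 1) z / ((a' : ℂ) ^ 3) - tubeLogZ ρ a (k + 1) z / ((a : ℂ) ^ 3)‖
      ≤ 12 * ((k + 1 : ℕ) : ℝ) * q := by exact_mod_cast h
    _ = 12 * q * ((k + 1 : ℕ) : ℝ) := by ring

open scoped Classical in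
/-- **The volume discrepancy of the thermal free-energy density, modulo lifting**: for spatial sides `2 ≤ a ≤ a'`, period `t ≥ 4` and
`‖z‖ ≤ r_ρ`, if the kept sums at cutoff `4(a−1)` agree per site for every period `T ≥ 4`, then
`‖volumeDiscrepancy ρ a a' t z‖ ≤ 24t·(‖z‖/(e r_ρ))^{4(a−1)+1}` — on the WHOLE closed disc, for complex `z`. -/
theorem norm_volumeDiscrepancy_le_of_lift (hρ : Continuous ρ) {a a' t : ℕ} (ha : 1 < a) (haa' : a ≤ a') (ht : 4 ≤ t)
    {z : ℂ} (hz : ‖z‖ ≤ strongCouplingRadius ρ)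
    (hlift : ∀ T : ℕ, 4 ≤ T →
      (∑ A ∈ (Finset.univ : Finset (BoxLabel (![a', a', a', T] : Fin 4 → ℕ))).powerset with
            ((∀ p ∈ A, ∀ e ∈ p.bonds, ∃ q ∈ A, q ≠ p ∧ e ∈ q.bonds) ∧
              IsRConnected (boxSystem (G := G) ρ (![a', a', a', T] : Fin 4 → ℕ)).Adj A ∧ A.card ≤ 4 * (a - 1)),
          ∑ 𝒞 ∈ (rconnSubsets (boxSystem (G := G) ρ (![a', a', a', T] : Fin 4 → ℕ)).Adj A).powerset with 𝒞.biUnion id = A,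
            truncatedWeight (GeomInc (boxSystem (G := G) ρ (![a', a', a', T] : Fin 4 → ℕ)).Adj)
              (connActivity (boxSystem (G := G) ρ (![a', a', a', T] : Fin 4 → ℕ)).Adj (zdHaar 4 G)
                ((boxSystem (G := G) ρ (![a', a', a', T] : Fin 4 → ℕ)).weight z)) 𝒞) / ((a' : ℂ) ^ 3) =
      (∑ A ∈ (Finset.univ : Finset (BoxLabel (![a, a, a, T] : Fin 4 → ℕ))).powerset with
            ((∀ p ∈ A, ∀ e ∈ p.bonds, ∃ q ∈ A, q ≠ p ∧ e ∈ q.bonds) ∧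
              IsRConnected (boxSystem (G := G) ρ (![a, a, a, T] : Fin 4 → ℕ)).Adj A ∧ A.card ≤ 4 * (a - 1)),
          ∑ 𝒞 ∈ (rconnSubsets (boxSystem (G := G) ρ (![a, a, a, T] : Fin 4 → ℕ)).Adj A).powerset with 𝒞.biUnion id = A,
            truncatedWeight (GeomInc (boxSystem (G := G) ρ (![a, a, a, T] : Fin 4 → ℕ)).Adj)
              (connActivity (boxSystem (G := G) ρ (![a, a, a, T] : Fin 4 → ℕ)).Adj (zdHaar 4 G)
                ((boxSystem (G := G) ρ (![a, a, a, T] : Fin 4 → ℕ)).weight z)) 𝒞) / ((a : ℂ) ^ 3)) :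
    ‖volumeDiscrepancy ρ a a' t z‖ ≤ 24 * t * (‖z‖ / (Real.exp 1 * strongCouplingRadius ρ)) ^ (4 * (a - 1) + 1) := by
  set q : ℝ := (‖z‖ / (Real.exp 1 * strongCouplingRadius ρ)) ^ (4 * (a - 1) + 1) with hq
  have h1 := norm_tubeLogZ_div_sub_le_of_kept_eq ρ hρ ha haa' (lt_of_lt_of_le (by norm_num) ht) hz (hlift t ht)
  have h2 := norm_tubeRate_div_sub_le_of_lift ρ hρ ha haa' hz hlift
  have heq : volumeDiscrepancy ρ a a' t z =
      (tubeLogZ ρ a' t z / ((a' : ℂ) ^ 3) - tubeLogZ ρ a t z / ((a : ℂ) ^ 3)) -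
        (t : ℂ) * (tubeRate ρ a' z / ((a' : ℂ) ^ 3) - tubeRate ρ a z / ((a : ℂ) ^ 3)) := by
    simp only [volumeDiscrepancy, thermalLogZ]
    ring
  rw [heq]
  calc ‖(tubeLogZ ρ a' t z / ((a' : ℂ) ^ 3) - tubeLogZ ρ a t z / ((a : ℂ) ^ 3)) -
        (t : ℂ) * (tubeRate ρ a' z / ((a' : ℂ) ^ 3) - tubeRate ρ a z / ((a : ℂ) ^ 3))‖
      ≤ ‖tubeLogZ ρ a' t z / ((a' : ℂ) ^ 3) - tubeLogZ ρ a t z / ((a : ℂ) ^ 3)‖ +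
          ‖(t : ℂ) * (tubeRate ρ a' z / ((a' : ℂ) ^ 3) - tubeRate ρ a z / ((a : ℂ) ^ 3))‖ := norm_sub_le _ _
    _ ≤ 12 * t * q + t * (12 * q) := by
        rw [norm_mul, Complex.norm_natCast]
        exact add_le_add h1 (mul_le_mul_of_nonneg_left h2 (Nat.cast_nonneg _))
    _ = 24 * t * q := by ring

open scoped Classical in
/-- **The volume discrepancy of the cold log-defect density (finite currency), modulo lifting**: for `2 ≤ a ≤ a'`, `t ≥ 4`, `‖z‖ ≤ r_ρ`, if the
kept sums agree per site at the periods `t` and `2t`, then `‖coldVolumeDiscrepancy ρ a a' t z‖ ≤ 48t·(‖z‖/(e r_ρ))^{4(a−1)+1}` (no tube rate). -/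
theorem norm_coldVolumeDiscrepancy_le_of_lift (hρ : Continuous ρ) {a a' t : ℕ} (ha : 1 < a) (haa' : a ≤ a') (ht : 4 ≤ t)
    {z : ℂ} (hz : ‖z‖ ≤ strongCouplingRadius ρ)
    (hlift : ∀ T : ℕ, 4 ≤ T →
      (∑ A ∈ (Finset.univ : Finset (BoxLabel (![a', a', a', T] : Fin 4 → ℕ))).powerset with
            ((∀ p ∈ A, ∀ e ∈ p.bonds, ∃ q ∈ A, q ≠ p ∧ e ∈ q.bonds) ∧
              IsRConnected (boxSystem (G := G) ρ (![a', a', a', T] : Fin 4 → ℕ)).Adj A ∧ A.card ≤ 4 * (a - 1)),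
          ∑ 𝒞 ∈ (rconnSubsets (boxSystem (G := G) ρ (![a', a', a', T] : Fin 4 → ℕ)).Adj A).powerset with 𝒞.biUnion id = A,
            truncatedWeight (GeomInc (boxSystem (G := G) ρ (![a', a', a', T] : Fin 4 → ℕ)).Adj)
              (connActivity (boxSystem (G := G) ρ (![a', a', a', T] : Fin 4 → ℕ)).Adj (zdHaar 4 G)
                ((boxSystem (G := G) ρ (![a', a', a', T] : Fin 4 → ℕ)).weight z)) 𝒞) / ((a' : ℂ) ^ 3) =
      (∑ A ∈ (Finset.univ : Finset (BoxLabel (![a, a, a, T] : Fin 4 → ℕ))).powerset with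
            ((∀ p ∈ A, ∀ e ∈ p.bonds, ∃ q ∈ A, q ≠ p ∧ e ∈ q.bonds) ∧
              IsRConnected (boxSystem (G := G) ρ (![a, a, a, T] : Fin 4 → ℕ)).Adj A ∧ A.card ≤ 4 * (a - 1)),
          ∑ 𝒞 ∈ (rconnSubsets (boxSystem (G := G) ρ (![a, a, a, T] : Fin 4 → ℕ)).Adj A).powerset with 𝒞.biUnion id = A,
            truncatedWeight (GeomInc (boxSystem (G := G) ρ (![a, a, a, T] : Fin 4 → ℕ)).Adj)
              (connActivity (boxSystem (G := G) ρ (![a, a, a, T] : Fin 4 → ℕ)).Adj (zdHaar 4 G)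
                ((boxSystem (G := G) ρ (![a, a, a, T] : Fin 4 → ℕ)).weight z)) 𝒞) / ((a : ℂ) ^ 3)) :
    ‖coldVolumeDiscrepancy ρ a a' t z‖ ≤ 48 * t * (‖z‖ / (Real.exp 1 * strongCouplingRadius ρ)) ^ (4 * (a - 1) + 1) := by
  set q : ℝ := (‖z‖ / (Real.exp 1 * strongCouplingRadius ρ)) ^ (4 * (a - 1) + 1) with hq
  have h2t : 4 ≤ 2 * t := by omega
  have h1 := norm_tubeLogZ_div_sub_le_of_kept_eq ρ hρ ha haa' (lt_of_lt_of_le (by norm_num) ht) hz (hlift t ht)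
  have h2 := norm_tubeLogZ_div_sub_le_of_kept_eq ρ hρ ha haa' (lt_of_lt_of_le (by norm_num) h2t) hz (hlift (2 * t) h2t)
  have heq : coldVolumeDiscrepancy ρ a a' t z =
      2 * (tubeLogZ ρ a' t z / ((a' : ℂ) ^ 3) - tubeLogZ ρ a t z / ((a : ℂ) ^ 3)) -
        (tubeLogZ ρ a' (2 * t) z / ((a' : ℂ) ^ 3) - tubeLogZ ρ a (2 * t) z / ((a : ℂ) ^ 3)) := by
    simp only [coldVolumeDiscrepancy, coldLogDefect]
    ring
  rw [heq]
  calc ‖2 * (tubeLogZ ρ a' t z / ((a' : ℂ) ^ 3) - tubeLogZ ρ a t z / ((a : ℂ) ^ 3)) -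
        (tubeLogZ ρ a' (2 * t) z / ((a' : ℂ) ^ 3) - tubeLogZ ρ a (2 * t) z / ((a : ℂ) ^ 3))‖
      ≤ ‖2 * (tubeLogZ ρ a' t z / ((a' : ℂ) ^ 3) - tubeLogZ ρ a t z / ((a : ℂ) ^ 3))‖ +
          ‖tubeLogZ ρ a' (2 * t) z / ((a' : ℂ) ^ 3) - tubeLogZ ρ a (2 * t) z / ((a : ℂ) ^ 3)‖ := norm_sub_le _ _
    _ ≤ 2 * (12 * t * q) + 12 * ((2 * t : ℕ) : ℝ) * q := by
        rw [norm_mul, Complex.norm_ofNat]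
        exact add_le_add (mul_le_mul_of_nonneg_left h1 zero_le_two) h2
    _ = 48 * t * q := by push_cast; ring

end TwoVolumes

/-! ## §2 The jet stubs of `ThermalFreeEnergyDefs` from the lifting identity over `T ≥ 4` -/

section Stubs

open scoped Classical in
/-- **Stub #1 (`ThermalFreeEnergyVolumeJets`) from the lifting identity.**  If for every compact `G`, faithful unitary `r`, spatial sides
`4 ≤ a ≤ a'`, period `T ≥ 4` and `‖z‖ ≤ r_ρ` the kept support sums at cutoff `4(a−1)` of the boxes `a'³×T` and `a³×T` agree per site
(piece C3: rooting at scale `a − 1` of closed connected supports with `≤ 4(a−1)` plaquettes, w2's `SlabCount.exists_rooting_of_closed`, and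
lifting between the boxes), then `volumeDiscrepancy r.ρ a a' t =O[𝓝 0] z^{3a}` for all `4 ≤ a ≤ a'`, `4 ≤ t` — indeed
`‖volumeDiscrepancy‖ ≤ 24t(‖z‖/(e r_ρ))^{4a−3}` on the disc and `3a ≤ 4a − 3`. -/
theorem thermalFreeEnergyVolumeJets_of_lift
    (hlift : ∀ (G : Type) [Group G] [TopologicalSpace G] [IsTopologicalGroup G] [CompactSpace G],
      letI : MeasurableSpace G := borel G
      haveI : BorelSpace G := ⟨rfl⟩
      ∀ (r : LatticeRep G) (a a' T : ℕ), 4 ≤ a → a ≤ a' → 4 ≤ T → ∀ z : ℂ, ‖z‖ ≤ strongCouplingRadius r.ρ →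
        (∑ A ∈ (Finset.univ : Finset (BoxLabel (![a', a', a', T] : Fin 4 → ℕ))).powerset with
            ((∀ p ∈ A, ∀ e ∈ p.bonds, ∃ q ∈ A, q ≠ p ∧ e ∈ q.bonds) ∧
              IsRConnected (boxSystem (G := G) r.ρ (![a', a', a', T] : Fin 4 → ℕ)).Adj A ∧ A.card ≤ 4 * (a - 1)),
          ∑ 𝒞 ∈ (rconnSubsets (boxSystem (G := G) r.ρ (![a', a', a', T] : Fin 4 → ℕ)).Adj A).powerset with 𝒞.biUnion id = A,
            truncatedWeight (GeomInc (boxSystem (G := G) r.ρ (![a', a', a', T] : Fin 4 → ℕ)).Adj)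
              (connActivity (boxSystem (G := G) r.ρ (![a', a', a', T] : Fin 4 → ℕ)).Adj (zdHaar 4 G)
                ((boxSystem (G := G) r.ρ (![a', a', a', T] : Fin 4 → ℕ)).weight z)) 𝒞) / ((a' : ℂ) ^ 3) =
        (∑ A ∈ (Finset.univ : Finset (BoxLabel (![a, a, a, T] : Fin 4 → ℕ))).powerset with
            ((∀ p ∈ A, ∀ e ∈ p.bonds, ∃ q ∈ A, q ≠ p ∧ e ∈ q.bonds) ∧
              IsRConnected (boxSystem (G := G) r.ρ (![a, a, a, T] : Fin 4 → ℕ)).Adj A ∧ A.card ≤ 4 * (a - 1)),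
          ∑ 𝒞 ∈ (rconnSubsets (boxSystem (G := G) r.ρ (![a, a, a, T] : Fin 4 → ℕ)).Adj A).powerset with 𝒞.biUnion id = A,
            truncatedWeight (GeomInc (boxSystem (G := G) r.ρ (![a, a, a, T] : Fin 4 → ℕ)).Adj)
              (connActivity (boxSystem (G := G) r.ρ (![a, a, a, T] : Fin 4 → ℕ)).Adj (zdHaar 4 G)
                ((boxSystem (G := G) r.ρ (![a, a, a, T] : Fin 4 → ℕ)).weight z)) 𝒞) / ((a : ℂ) ^ 3)) :
    ThermalFreeEnergyVolumeJets := by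
  intro G _ _ _ _
  letI : MeasurableSpace G := borel G
  haveI : BorelSpace G := ⟨rfl⟩
  intro r a a' t ha haa' ht
  have hr := strongCouplingRadius_pos r.ρ
  set C : ℝ := 24 * t / (Real.exp 1 * strongCouplingRadius r.ρ) ^ (4 * (a - 1) + 1) with hC
  refine Asymptotics.IsBigO.of_bound C ?_
  have hball : Metric.closedBall (0 : ℂ) (min (strongCouplingRadius r.ρ) 1) ∈ 𝓝 (0 : ℂ) :=
    Metric.closedBall_mem_nhds _ (lt_min hr one_pos)
  filter_upwards [hball] with z hz
  rw [Metric.mem_closedBall, dist_zero_right, le_min_iff] at hz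
  have ha1 : 1 < a := by omega
  have h := norm_volumeDiscrepancy_le_of_lift r.ρ r.continuous ha1 haa' ht hz.1
    fun T hT => hlift G r a a' T ha haa' hT z hz.1
  refine h.trans ?_
  rw [div_pow, norm_pow]
  have hexp : ‖z‖ ^ (4 * (a - 1) + 1) ≤ ‖z‖ ^ (3 * a) :=
    pow_le_pow_of_le_one (norm_nonneg _) hz.2 (by omega)
  have hCnn : 0 ≤ C := by positivity
  calc 24 * (t : ℝ) * (‖z‖ ^ (4 * (a - 1) + 1) / (Real.exp 1 * strongCouplingRadius r.ρ) ^ (4 * (a - 1) + 1))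
      = C * ‖z‖ ^ (4 * (a - 1) + 1) := by rw [hC]; ring
    _ ≤ C * ‖z‖ ^ (3 * a) := mul_le_mul_of_nonneg_left hexp hCnn

open scoped Classical in
/-- **The finite-currency stub (`ColdFreeEnergyVolumeJets`) from the lifting identity**, likewise:
`‖coldVolumeDiscrepancy‖ ≤ 48t(‖z‖/(e r_ρ))^{4a−3}` on the disc, hence `=O[𝓝 0] z^{3a}`. -/
theorem coldFreeEnergyVolumeJets_of_lift
    (hlift : ∀ (G : Type) [Group G] [TopologicalSpace G] [IsTopologicalGroup G] [CompactSpace G],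
      letI : MeasurableSpace G := borel G
      haveI : BorelSpace G := ⟨rfl⟩
      ∀ (r : LatticeRep G) (a a' T : ℕ), 4 ≤ a → a ≤ a' → 4 ≤ T → ∀ z : ℂ, ‖z‖ ≤ strongCouplingRadius r.ρ →
        (∑ A ∈ (Finset.univ : Finset (BoxLabel (![a', a', a', T] : Fin 4 → ℕ))).powerset with
            ((∀ p ∈ A, ∀ e ∈ p.bonds, ∃ q ∈ A, q ≠ p ∧ e ∈ q.bonds) ∧
              IsRConnected (boxSystem (G := G) r.ρ (![a', a', a', T] : Fin 4 → ℕ)).Adj A ∧ A.card ≤ 4 * (a - 1)),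
          ∑ 𝒞 ∈ (rconnSubsets (boxSystem (G := G) r.ρ (![a', a', a', T] : Fin 4 → ℕ)).Adj A).powerset with 𝒞.biUnion id = A,
            truncatedWeight (GeomInc (boxSystem (G := G) r.ρ (![a', a', a', T] : Fin 4 → ℕ)).Adj)
              (connActivity (boxSystem (G := G) r.ρ (![a', a', a', T] : Fin 4 → ℕ)).Adj (zdHaar 4 G)
                ((boxSystem (G := G) r.ρ (![a', a', a', T] : Fin 4 → ℕ)).weight z)) 𝒞) / ((a' : ℂ) ^ 3) =
        (∑ A ∈ (Finset.univ : Finset (BoxLabel (![a, a, a, T] : Fin 4 → ℕ))).powerset with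
            ((∀ p ∈ A, ∀ e ∈ p.bonds, ∃ q ∈ A, q ≠ p ∧ e ∈ q.bonds) ∧
              IsRConnected (boxSystem (G := G) r.ρ (![a, a, a, T] : Fin 4 → ℕ)).Adj A ∧ A.card ≤ 4 * (a - 1)),
          ∑ 𝒞 ∈ (rconnSubsets (boxSystem (G := G) r.ρ (![a, a, a, T] : Fin 4 → ℕ)).Adj A).powerset with 𝒞.biUnion id = A,
            truncatedWeight (GeomInc (boxSystem (G := G) r.ρ (![a, a, a, T] : Fin 4 → ℕ)).Adj)
              (connActivity (boxSystem (G := G) r.ρ (![a, a, a, T] : Fin 4 → ℕ)).Adj (zdHaar 4 G)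
                ((boxSystem (G := G) r.ρ (![a, a, a, T] : Fin 4 → ℕ)).weight z)) 𝒞) / ((a : ℂ) ^ 3)) :
    ColdFreeEnergyVolumeJets := by
  intro G _ _ _ _
  letI : MeasurableSpace G := borel G
  haveI : BorelSpace G := ⟨rfl⟩
  intro r a a' t ha haa' ht
  have hr := strongCouplingRadius_pos r.ρ
  set C : ℝ := 48 * t / (Real.exp 1 * strongCouplingRadius r.ρ) ^ (4 * (a - 1) + 1) with hC
  refine Asymptotics.IsBigO.of_bound C ?_
  have hball : Metric.closedBall (0 : ℂ) (min (strongCouplingRadius r.ρ) 1) ∈ 𝓝 (0 : ℂ) :=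
    Metric.closedBall_mem_nhds _ (lt_min hr one_pos)
  filter_upwards [hball] with z hz
  rw [Metric.mem_closedBall, dist_zero_right, le_min_iff] at hz
  have ha1 : 1 < a := by omega
  have h := norm_coldVolumeDiscrepancy_le_of_lift r.ρ r.continuous ha1 haa' ht hz.1
    fun T hT => hlift G r a a' T ha haa' hT z hz.1
  refine h.trans ?_
  rw [div_pow, norm_pow]
  have hexp : ‖z‖ ^ (4 * (a - 1) + 1) ≤ ‖z‖ ^ (3 * a) :=
    pow_le_pow_of_le_one (norm_nonneg _) hz.2 (by omega)
  have hCnn : 0 ≤ C := by positivity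
  calc 48 * (t : ℝ) * (‖z‖ ^ (4 * (a - 1) + 1) / (Real.exp 1 * strongCouplingRadius r.ρ) ^ (4 * (a - 1) + 1))
      = C * ‖z‖ ^ (4 * (a - 1) + 1) := by rw [hC]; ring
    _ ≤ C * ‖z‖ ^ (3 * a) := mul_le_mul_of_nonneg_left hexp hCnn

end Stubs



end Summit.QuantumFields.YangMills.Theorems.GlueballBandRecursion.Thermal

end
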